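import Literature.NumberTheory.EllipticCurves.WeierstrassAddLawCharts
import HarnessLib

/-!
# The addition morphism of the Weierstrass cubic is the chord–tangent law on `L`-points, for every field `L ⊇ K`

Companion (theorems only) of `Literature/NumberTheory/EllipticCurves/WeierstrassAddAtlas.lean` and
`WeierstrassAddLawCharts.lean`. There the addition morphism `W.addHom : E_W ×_K E_W → E_W` of the
smooth plane cubic `E_W` of an elliptic curve `W/K` (Silverman, *AEC* III.3.6) is glued from the
law charts of the two complete addition laws of Bosma–Lenstra, and its value on GEOMETRIC points
(`K̄ = AlgebraicClosure K`) is identified with Mathlib's group law: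
`⟨[P], [Q]⟩ ≫ addHom = [P + Q]` (`lift_pointEquiv_comp_addHom`). The chart-level inputs of that
proof (`specOverOfAlgHom_comp_lawμ`, `specOverOfAlgHom_comp_lawι_fst/snd`,
`pointEquiv_symm_schemePoint_addXYZ/add₂XYZ`) are valid for points with values in ANY field
`L ⊇ K`; this file records the resulting identification for all `L`:

* `WeierstrassCurve.pointEquiv_symm_schemePoint_law` — `[law i P Q] = [P] + [Q]` in `W(L)`;
* `WeierstrassCurve.pointEquiv_symm_comp_addHom` — for every `L`-point `p` of `E_W ×_K E_W`,
  `addHom (p) = pr₁ p + pr₂ p` in `W(L)`;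
* `WeierstrassCurve.lift_pointEquiv_comp_addHom_of_field` — `⟨[P], [Q]⟩ ≫ addHom = [P + Q]` for
  `P, Q ∈ W(L)`.

Consumer: the complex uniformisation `ℂ → E(ℂ)`, `z ↦ [℘(z), ℘'(z)/2, 1]`, as a homomorphism for
the group-SCHEME law on `E(ℂ)` (`K = L = ℂ`), where `K̄ = AlgebraicClosure ℂ` is not
syntactically `ℂ`. Silverman, *AEC* III.2 (the group law on `E(L)` for every `L ⊇ K`), III.3.6.

## References

* J. H. Silverman, *The Arithmetic of Elliptic Curves*, 2nd ed., GTM 106 (2009): III.2, III.3.6.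
  [SilvermanAEC2009]
* W. Bosma, H. W. Lenstra, J. Number Theory 53 (1995), Theorem 2. [BosmaLenstra1995]
-/

noncomputable section

open CategoryTheory MonoidalCategory CartesianMonoidalCategory AlgebraicGeometry
open Literature.AlgebraicGeometry.Motives Literature.NumberTheory.EllipticCurves
open scoped Classical

universe u

namespace WeierstrassCurve

variable {K : Type u} [Field K] (W : WeierstrassCurve K) [W.IsElliptic] {L : Type u} [Field L] [Algebra K L]

/-- **`[law i P Q] = [P] + [Q]` in `W(L)`** for every field `L ⊇ K`, wherever the `i`-th complete
addition law is non-zero (`pointEquiv_symm_schemePoint_addXYZ`, `…_add₂XYZ`).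
[cite: SilvermanAEC2009, III.3.6] [cite: BosmaLenstra1995, Theorem 2] -/
theorem pointEquiv_symm_schemePoint_law (i : Fin 2) {P Q : Fin 3 → L}
    (hP0 : P ≠ 0) (hPe : (W.baseChange L).toProjective.Equation P)
    (hQ0 : Q ≠ 0) (hQe : (W.baseChange L).toProjective.Equation Q)
    (h0 : W.law L i P Q ≠ 0) (he : (W.baseChange L).toProjective.Equation (W.law L i P Q)) :
    W.pointEquiv.symm (W.schemePoint (W.law L i P Q) h0 he) =
      W.pointEquiv.symm (W.schemePoint P hP0 hPe) + W.pointEquiv.symm (W.schemePoint Q hQ0 hQe) := by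
  fin_cases i
  · exact W.pointEquiv_symm_schemePoint_addXYZ hP0 hPe hQ0 hQe h0 he
  · exact W.pointEquiv_symm_schemePoint_add₂XYZ hP0 hPe hQ0 hQe h0 he

/-- **The glued addition is the group law on `L`-points, for every field `L ⊇ K`**: for every
`L`-point `p` of `E_W ×_K E_W`, `addHom (p) = pr₁ p + pr₂ p` in `W(L)` (the point lies in the source
of some law chart `(c, d, i, e)` of `W.addAtlas`, which computes the `i`-th complete law; verbatim
the proof of `AddAtlas.toGeomPoint_addHom` with `K̄` replaced by `L`). [cite: SilvermanAEC2009, III.3.6] -/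
theorem pointEquiv_symm_comp_addHom (p : AlgPoints (W.scheme ⊗ W.scheme) L) :
    W.pointEquiv.symm (p ≫ W.addHom) =
      W.pointEquiv.symm (p ≫ fst W.scheme W.scheme) + W.pointEquiv.symm (p ≫ snd W.scheme W.scheme) := by
  set A := W.addAtlas with hA
  set pl : Spec (CommRingCat.of L) ⟶ (W.scheme ⊗ W.scheme).left := p.left with hpl
  obtain ⟨j, y, hy⟩ := A.covers (pl (IsLocalRing.closedPoint L))
  have hrange : Set.range pl ⊆ Set.range (A.chart j).ι := by
    rintro _ ⟨s, hs⟩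
    rw [← hs, Subsingleton.elim s (IsLocalRing.closedPoint L)]
    exact ⟨y, hy⟩
  let ℓ : Spec (CommRingCat.of L) ⟶ Spec (CommRingCat.of (A.chart j).S) :=
    IsOpenImmersion.lift (A.chart j).ι pl hrange
  have hℓ : ℓ ≫ (A.chart j).ι = pl := IsOpenImmersion.lift_fac _ _ _
  have hpo : pl ≫ (W.scheme ⊗ W.scheme).hom = Spec.map (CommRingCat.ofHom (algebraMap K L)) := Over.w p
  obtain ⟨β, hβ⟩ := exists_eq_specMap (K := K) ℓ (by
    rw [← LawChart.ι_over, ← Category.assoc, hℓ]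
    exact hpo)
  have hp : p = specPoint (A.chart j).ι (A.chart j).ι_over β := by
    refine Over.OverMorphism.ext ?_
    rw [specPoint_left, ← hβ, hℓ]
  have hval : p ≫ W.addHom = specPoint (A.chart j).μ (A.chart j).μ_over β := by
    refine Over.OverMorphism.ext ?_
    rw [Over.comp_left, specPoint_left, ← hβ]
    change pl ≫ A.addHom.left = ℓ ≫ (A.chart j).μ
    rw [← hℓ, Category.assoc, AddAtlas.ι_comp_addHom_left]
  rw [hval, hp]
  obtain ⟨c, d, i, e⟩ := j
  change W.pointEquiv.symm (specPoint (W.lawμ c d i e).left (Over.w _) β) =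
    W.pointEquiv.symm (specPoint (W.lawι c d i e).left (Over.w _) β ≫ fst _ _) +
      W.pointEquiv.symm (specPoint (W.lawι c d i e).left (Over.w _) β ≫ snd _ _)
  rw [specPoint_left_eq, specPoint_left_eq, specOverOfAlgHom_comp_lawμ, Category.assoc,
    specOverOfAlgHom_comp_lawι_fst, Category.assoc, specOverOfAlgHom_comp_lawι_snd]
  exact W.pointEquiv_symm_schemePoint_law i _ _ _ _ _ _

/-- **`⟨[P], [Q]⟩ ≫ addHom = [P + Q]` on `L`-points, for every field `L ⊇ K`** (the geometric
case `L = K̄` is `lift_pointEquiv_comp_addHom`). Silverman, *AEC* III.2–III.3.6: the morphism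
`E × E → E` restricts to the chord–tangent law on `E(L)` for every `L`. [cite: SilvermanAEC2009, III.3.6] -/
theorem lift_pointEquiv_comp_addHom_of_field (P Q : (W.baseChange L).toAffine.Point) :
    lift (W.pointEquiv P) (W.pointEquiv Q) ≫ W.addHom = W.pointEquiv (P + Q) := by
  have h := W.pointEquiv_symm_comp_addHom (L := L) (lift (W.pointEquiv P) (W.pointEquiv Q))
  rw [lift_fst, lift_snd, Equiv.symm_apply_apply, Equiv.symm_apply_apply] at h
  rw [← (W.pointEquiv (L := L)).apply_symm_apply (lift _ _ ≫ W.addHom), h]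

end WeierstrassCurve

end
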